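import Summits.BirchSwinnertonDyer.BirchSwinnertonDyer.Theorems.GenusKolyvaginAtTwoGenusPrimitiveSupplyAtTwoTwoAdicImageOverK
import Literature.NumberTheory.EllipticCurves.DivisionTowerH1AnnihilatorOfHomothetyProofs
import Literature.NumberTheory.EllipticCurves.DivisionTowerH1OrderTwoSurjective
import Summits.BirchSwinnertonDyer.BirchSwinnertonDyer.Theorems.GenusKolyvaginAtTwoPhantomKernelAtTwo
import HarnessLib

/-!
# Route `GenusKolyvaginAtTwo`, crux `GenusPrimitiveSupplyAtTwo` (stmt-BirchSwinnertonDyer-22136):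
# Lawson–Wuthrich at the even prime OVER THE HEEGNER FIELD — `2·H¹(K(E[2^k])/K, E[2^k]) = 0` and
# `#H¹(Gal(L/K), E(L)[2^k]) ≤ 2` on the crux habitat, by name

Seat `bsd-line-gk2-p5` g13 (WIDTH-5 attach, SUPPLY lineage; helper `--supports
stmt-BirchSwinnertonDyer-22136`). THEOREMS ONLY: no definition, no named fact, no `sorry`; no item is
closed; BSD is not proved by any of this.

The LEAD's files `DivisionTowerH1AnnihilatorOfHomothetyProofs` (`2·H¹ = 0` from the homothety `−1`,
Sah / Lawson–Wuthrich Lemma 3) and `DivisionTowerH1OrderTwoSurjective` (the order bound `#H¹ ≤ 2` for the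
full image `GL₂(ℤ/2^k)`) take `HasSurjectiveModNGaloisRep` OVER THE BASE FIELD OF THE `H¹`; on the crux
habitat that base field is the Heegner field `K`, where the `2`-adic image is supplied by
`GenusKolyTwoAdicK.hasSurjectiveModNGaloisRep_baseChange_two_pow`
(`…TwoAdicImageOverK.lean`: `ρ̄_{W,2ⁿ}` onto over `ℚ` + `d_K` odd + `d_K·(−|Δ|), d_K·(−2|Δ|) ∉ ℚ²` ⟹ onto
over `K`). This file composes the two, in the crux's spelling of the hypotheses:

* `two_zsmul_eq_zero_of_forall_h1Eval_eq_zero_heegner` — `x ∈ H¹(K, E[2^k])` with `[x, ρ] = 0` for all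
  `ρ ∈ Γ_{K(E[2^k])}` has `2x = 0` (the (H2′)-type input of LINE 6 at `2`, up to the factor `2`);
* `natCard_subgroupResKer_two_pow_le_two_heegner` — `#ker (H¹(Γ_K, E[2^k]) → H¹(N, E[2^k])) ≤ 2` for every
  `N ⊇ Γ_{K(E[2^k])}`, i.e. `#H¹(Gal(L/K), E(L)[2^k]) ≤ 2` for all `K ⊆ L ⊆ K(E[2^k])`;
* `eq_zero_or_eq_zero_or_eq_of_forall_h1Eval_eq_zero_heegner` — two such classes are `0` or equal;
* `sel_visible_two_heegner` — LINE 6's (H2′) with its kernel inputs discharged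
  (`GenusKolyKernelAtTwo.sel_visible_two_of_hasSurjectiveModNGaloisRep_baseChange`, LEAD g11 p662512) made
  UNCONDITIONAL on the habitat: `s₁ ∈ Sel^{(2^M)}(E/ℚ)`, `s₂ ∈ Sel^{(2^M)}(E^{(d_K)}/ℚ)` with
  `rK₁ s₁ + rK₂ s₂ = 0` over `K` have `2s₁ = 0 ∧ 2s₂ = 0`.

References: [LawsonWuthrich2016] T. Lawson, C. Wuthrich, *Vanishing of some Galois cohomology groups
for elliptic curves* (2016), Lemma 3, §7.1; [Sah1968] Prop. 2.7 (b); [GrossLMS1991] §9;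
[DokchitserDokchitserMathZ2012] Theorem.
-/

-- single-conjunct summit: `Summit.BirchSwinnertonDyer.BirchSwinnertonDyer.…` repeats the name by design
set_option linter.dupNamespace false
set_option autoImplicit false

noncomputable section

open scoped Classical

namespace Summit.BirchSwinnertonDyer.BirchSwinnertonDyer.Theorems.GenusKolyTwoAdicK

open WeierstrassCurve Field
open Literature.NumberTheory.EllipticCurves Literature.NumberTheory.GaloisRepresentations
open Summit.BirchSwinnertonDyer.BirchSwinnertonDyer.Theorems.GenusExact.VisiblePairAtTwo

/-! ### §6 Consumers on the habitat: Lawson–Wuthrich at the even prime OVER THE HEEGNER FIELD -/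

section Habitat

variable {K : Type} [Field K] [NumberField K] (W : WeierstrassCurve ℚ) [W.IsElliptic]

/-- The transfer in the `ℕ`-cast spelling `((2 ^ n : ℕ) : ℤ)` used by the division-tower files
(`DivisionTowerH1OrderTwoSurjective`, `GenusKolyvaginAtTwoPhantomKernelAtTwo`). [folklore] -/
theorem hasSurjectiveModNGaloisRep_baseChange_two_pow_natCast (hK : IsImaginaryQuadratic K)
    (hodd : Odd (NumberField.discr K))
    (hnsq₁ : ¬ IsSquare ((NumberField.discr K : ℚ) * -|W.Δ|))
    (hnsq₂ : ¬ IsSquare ((NumberField.discr K : ℚ) * (-(2 * |W.Δ|))))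
    (hρ : ∀ n : ℕ, 0 < n → W.HasSurjectiveModNGaloisRep ((2 : ℤ) ^ n)) {n : ℕ} (hn : 0 < n) :
    (W.baseChange K).HasSurjectiveModNGaloisRep ((2 ^ n : ℕ) : ℤ) := by
  have := hasSurjectiveModNGaloisRep_baseChange_two_pow W hK hodd hnsq₁ hnsq₂ hρ n hn
  exact_mod_cast this

/-- **`2 · H¹(K(E[2^k])/K, E[2^k]) = 0` over the Heegner field, in the pairing currency.** On the crux
habitat (`ρ̄_{W,2ⁿ}` onto over `ℚ` for all `n ≥ 1`) with its Heegner field `K` (`d_K` odd and the two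
side conditions): for every `k ≥ 1` and every class `x ∈ H¹(K, E[2^k])` with `[x, ρ] = 0` for all
`ρ ∈ Γ_{K(E[2^k])}`, `2x = 0` — the LEAD's
`LawsonWuthrich2016.two_zsmul_eq_zero_of_forall_h1Eval_eq_zero_of_hasSurjectiveModNGaloisRep` fed with
`hasSurjectiveModNGaloisRep_baseChange_two_pow`. [cite: LawsonWuthrich2016, Lemma 3]
[cite: GrossLMS1991, §9 (pairing after Prop. 9.1)] -/
theorem two_zsmul_eq_zero_of_forall_h1Eval_eq_zero_heegner (hK : IsImaginaryQuadratic K)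
    (hodd : Odd (NumberField.discr K))
    (hnsq₁ : ¬ IsSquare ((NumberField.discr K : ℚ) * -|W.Δ|))
    (hnsq₂ : ¬ IsSquare ((NumberField.discr K : ℚ) * (-(2 * |W.Δ|))))
    (hρ : ∀ n : ℕ, 0 < n → W.HasSurjectiveModNGaloisRep ((2 : ℤ) ^ n)) {k : ℕ} (hk : 0 < k)
    {x : galH1Torsion (W.baseChange K) ((2 : ℤ) ^ k)}
    (hx : ∀ ρ ∈ torsionFixing (W.baseChange K) ((2 : ℤ) ^ k),
      h1Eval (W.baseChange K) ((2 : ℤ) ^ k) x ρ = 0) :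
    (2 : ℤ) • x = 0 := by
  haveI : (W.baseChange K).IsElliptic := by rw [baseChange]; infer_instance
  exact LawsonWuthrich2016.two_zsmul_eq_zero_of_forall_h1Eval_eq_zero_of_hasSurjectiveModNGaloisRep
    (W.baseChange K) (pow_ne_zero k two_ne_zero)
    (hasSurjectiveModNGaloisRep_baseChange_two_pow W hK hodd hnsq₁ hnsq₂ hρ k hk) hx

/-- **`#H¹(Gal(L/K), E(L)[2^k]) ≤ 2` over the Heegner field** for every `L` with
`K ⊆ L ⊆ K(E[2^k])` (`N = Gal(K̄/L) ⊇ Γ_{K(E[2^k])}`), on the crux habitat with its Heegner field — the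
LEAD's order bound `LawsonWuthrich2016.natCard_subgroupResKer_two_pow_le_two` (Lawson–Wuthrich 2016 at
the even prime) fed with `hasSurjectiveModNGaloisRep_baseChange_two_pow` at level `2^(j+1)`.
[cite: LawsonWuthrich2016, Lemma 3, §7.1] [cite: Sah1968, Prop. 2.7 (b)] -/
theorem natCard_subgroupResKer_two_pow_le_two_heegner (hK : IsImaginaryQuadratic K)
    (hodd : Odd (NumberField.discr K))
    (hnsq₁ : ¬ IsSquare ((NumberField.discr K : ℚ) * -|W.Δ|))
    (hnsq₂ : ¬ IsSquare ((NumberField.discr K : ℚ) * (-(2 * |W.Δ|))))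
    (hρ : ∀ n : ℕ, 0 < n → W.HasSurjectiveModNGaloisRep ((2 : ℤ) ^ n)) (j : ℕ)
    (N : Subgroup (absoluteGaloisGroup K))
    (hle : torsionFixing (W.baseChange K) ((2 ^ (j + 1) : ℕ) : ℤ) ≤ N) :
    Nat.card (subgroupResKer (geomTorsion (W.baseChange K) ((2 ^ (j + 1) : ℕ) : ℤ)) N) ≤ 2 := by
  haveI : (W.baseChange K).IsElliptic := by rw [baseChange]; infer_instance
  exact LawsonWuthrich2016.natCard_subgroupResKer_two_pow_le_two (W.baseChange K) j two_ne_zero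
    (hasSurjectiveModNGaloisRep_baseChange_two_pow_natCast W hK hodd hnsq₁ hnsq₂ hρ (Nat.succ_pos j))
    N hle

/-- **Two classes of `H¹(K, E[2^k])` vanishing on `Γ_{K(E[2^k])}` are `0` or EQUAL**, over the Heegner
field on the crux habitat — the pairing form of the order bound
(`LawsonWuthrich2016.eq_zero_or_eq_zero_or_eq_of_forall_h1Eval_eq_zero`): the `p = 2` replacement of
the injectivity `(∀ ρ ∈ Γ_{K(E[n])}, [x, ρ] = 0) → x = 0` used by the `p`-odd Kolyvagin arguments.
[cite: LawsonWuthrich2016, Lemma 3, §7.1] [cite: GrossLMS1991, §9 (pairing after Prop. 9.1)] -/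
theorem eq_zero_or_eq_zero_or_eq_of_forall_h1Eval_eq_zero_heegner (hK : IsImaginaryQuadratic K)
    (hodd : Odd (NumberField.discr K))
    (hnsq₁ : ¬ IsSquare ((NumberField.discr K : ℚ) * -|W.Δ|))
    (hnsq₂ : ¬ IsSquare ((NumberField.discr K : ℚ) * (-(2 * |W.Δ|))))
    (hρ : ∀ n : ℕ, 0 < n → W.HasSurjectiveModNGaloisRep ((2 : ℤ) ^ n)) (j : ℕ)
    {x₁ x₂ : galH1Torsion (W.baseChange K) ((2 ^ (j + 1) : ℕ) : ℤ)}
    (hx₁ : ∀ ρ ∈ torsionFixing (W.baseChange K) ((2 ^ (j + 1) : ℕ) : ℤ),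
      h1Eval (W.baseChange K) _ x₁ ρ = 0)
    (hx₂ : ∀ ρ ∈ torsionFixing (W.baseChange K) ((2 ^ (j + 1) : ℕ) : ℤ),
      h1Eval (W.baseChange K) _ x₂ ρ = 0) :
    x₁ = 0 ∨ x₂ = 0 ∨ x₁ = x₂ := by
  haveI : (W.baseChange K).IsElliptic := by rw [baseChange]; infer_instance
  exact LawsonWuthrich2016.eq_zero_or_eq_zero_or_eq_of_forall_h1Eval_eq_zero (W.baseChange K) j
    two_ne_zero
    (hasSurjectiveModNGaloisRep_baseChange_two_pow_natCast W hK hodd hnsq₁ hnsq₂ hρ (Nat.succ_pos j))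
    hx₁ hx₂

/-- **LINE 6's (H2′), UNCONDITIONAL ON THE HABITAT.** For `W/ℚ` with `ρ̄_{W,2ⁿ}` onto for all `n ≥ 1`,
`K` imaginary quadratic with `d_K` odd and the two side conditions, `θ ∈ K ∖ ℚ` with `θ² = d_K`, and
`M = j + 1 ≥ 1`: every `s₁ ∈ Sel^{(2^M)}(E/ℚ)`, `s₂ ∈ Sel^{(2^M)}(E^{(d_K)}/ℚ)` with `rK₁ s₁ + rK₂ s₂ = 0` in
`H¹(K, E[2^M])` satisfy `2s₁ = 0 ∧ 2s₂ = 0` — the LEAD's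
`GenusKolyKernelAtTwo.sel_visible_two_of_hasSurjectiveModNGaloisRep_baseChange` (gk2-p3 g14's
`sel_visible_two_of_kernel_inputs` with `hNfix`, `hN2` discharged modulo `2^M`-surjectivity over `K`) fed
with `hasSurjectiveModNGaloisRep_baseChange_two_pow`. [cite: McCallumLMS1991, p. 299]
[cite: LawsonWuthrich2016, §7.1] -/
theorem sel_visible_two_heegner (hK : IsImaginaryQuadratic K) (hodd : Odd (NumberField.discr K))
    (hnsq₁ : ¬ IsSquare ((NumberField.discr K : ℚ) * -|W.Δ|))
    (hnsq₂ : ¬ IsSquare ((NumberField.discr K : ℚ) * (-(2 * |W.Δ|))))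
    (hρ : ∀ n : ℕ, 0 < n → W.HasSurjectiveModNGaloisRep ((2 : ℤ) ^ n))
    {θ : K} (hθ : θ ∉ Set.range (algebraMap ℚ K))
    (hθsq : θ ^ 2 = algebraMap ℚ K ((NumberField.discr K : ℤ) : ℚ)) (j : ℕ) :
    ∀ s₁ ∈ selmerGroup W (lvl (j + 1)), ∀ s₂ ∈ selmerGroup (twin W K) (lvl (j + 1)),
      rK₁ W K (j + 1) s₁ + rK₂ W (j + 1) hθ hθsq s₂ = 0 → (2 : ℤ) • s₁ = 0 ∧ (2 : ℤ) • s₂ = 0 := by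
  have hs : W.HasSurjectiveModNGaloisRep 2 := by simpa using hρ 1 one_pos
  exact GenusKolyKernelAtTwo.sel_visible_two_of_hasSurjectiveModNGaloisRep_baseChange W K j hK hK.1
    hθ hθsq hs
    (hasSurjectiveModNGaloisRep_baseChange_two_pow_natCast W hK hodd hnsq₁ hnsq₂ hρ (Nat.succ_pos j))

end Habitat

end Summit.BirchSwinnertonDyer.BirchSwinnertonDyer.Theorems.GenusKolyTwoAdicK

end
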